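/-
Copyright (c) 2026 the pub-hodgecm-mathlib formalisation cell (harness21).  Prover seat hodgecm-mathlib-F0P3a-p08 (g20): road «S3-ram» (LEAD F0P3a-plan (g13);
owner F0P3a-p06 (g15)), (T2) G-side organ (Cnt2′) (chair F0P3a-p07 (g14) RULINGS (9)(b)∕(10)(3)), organ (z6) «FIX-FINITE, BLOCK LITERAL», part (z6-e)
«J₀ DRESS OF THE OPPOSITE LITERAL `P·ι(γ₁, u)·P⁻¹`»; 2026-09-02.
-/
import Literature.NumberTheory.Automorphic.UnitaryLatticeTreeBlockTubeBoundFixedFinite   -- ★ p848710 (this seat): THM B′ `finite_setOf_latticeGraphIso_endoGL_eq_of_det_ne_zero`, `eval_charpoly_fin_two_eq_det_sub_smul_one`; brings ★ `isTree_latticeGraph_three_of_neg`, ★ `finite_neighborSet_of_ramified`, ★ alternation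
import Literature.NumberTheory.Automorphic.UnitaryLatticeTreeFixedFiniteModelTransport      -- ★ (F0P3a-p05): `finite_setOf_latticeGraphIso_eq_of_model`; brings ★ FormTransport (`exists_iso_latticeGraph_formCongr`, `isTree_latticeGraph_formCongr_iff`), ★ FrameChange (`isSelfDualLattice_formCongr_iff`)
import Literature.NumberTheory.Automorphic.UnitaryLatticeTreeAnisotropicPlane               -- ★ p847364 (F0P3a-p03): `eq_stdLattice_of_isSelfDualLattice_of_anisotropic`
import Literature.NumberTheory.Automorphic.UnitaryConjClassClosed                           -- ★ `formCongr_mul`, `formCongr_mul_of_mem`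
import HarnessLib

/-!
# The lattice graph of a hermitian space — the fixed set of the OPPOSITE type-(2) literal `P·ι(γ₁, u)·P⁻¹` (block frame `ι-shape(diag d, η)`, `diag d` residually
# anisotropic) in the `Φ₃`-model is finite (Bruhat–Tits 1972 §10; Kottwitz 1986 §3)

Topic `NumberTheory/Automorphic`; namespace `Literature.NumberTheory.Automorphic.UnitaryLatticeTree`.  THEOREMS ONLY (no definition, no instance, no notation, no named fact,
no `sorry`); kernel lane `--supports stmt-HodgeConjecture-24833`; datum-free (`K` with `Valued K ℤᵐ⁰`; `[IsPrincipalIdealRing 𝒪[K]]` discharged downstream by ★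
`isPrincipalIdealRing_integer_adicCompletion`).  Cell `pub/hodgecm-mathlib` (D-0151), crux H413; road «S3-ram» (Literature seeding, count-neutral); (T2) G-side organ (Cnt2′)
(chair F0P3a-p07 (g14)), organ **(z6) «FIX-FINITE, BLOCK LITERAL»**, part **(z6-e)**: the `hFfin` binder of the route-B head `strataCount_J₀_block` (F0P2-p02 (g14)) at the
SECOND type-(2) literal `t₁`, whose matrix in the `Φ₃`-model is `P·ι(γ₁, u)·P⁻¹` with `formCongr σ P Φ₃ = ι-shape(diag d, η)` and `diag d` RESIDUALLY ANISOTROPIC (★ A-p19 (g28)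
`exists_vDeep_oppositeLiteral_frame_ram`: the binders `hP hd hdσ hanis₀ hanis₁ hησ hη hγ` below are its conclusions verbatim).

THE MATHEMATICS.  In the block model `H′ = formCongr σ P Φ₃ = ι-shape(diag d, η)` the element `Γ = ι(γ₁, u)` is unitary (`γ ∈ U(σ, Φ₃)`, `↑γ = PΓP⁻¹`), and ★ THM B′
(`finite_setOf_latticeGraphIso_endoGL_eq_of_det_ne_zero`, p848710) applies: the `W`-side input is FREE because the residually anisotropic unimodular plane `(K², diag d)` has
exactly one self-dual lattice, the root `𝒪²` (★ `eq_stdLattice_of_isSelfDualLattice_of_anisotropic`), and the graph hypotheses (tree, alternation, finite stars) move from `Φ₃`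
to the model along the graph isomorphism `M ↦ P·M` (★ `exists_iso_latticeGraph_formCongr`, ★ `isTree_latticeGraph_formCongr_iff`, ★ `isSelfDualLattice_formCongr_iff`).
Finally ★ `finite_setOf_latticeGraphIso_eq_of_model` carries the finiteness of `Fix(Γ)` in the model to `Fix(γ)` in the `Φ₃`-model.

* §1 `finite_setOf_selfDual_fixed_of_anisotropic` (the anisotropic `W`-side: `{B ∣ SD(diag d) B ∧ γ₁B = B} ⊆ {𝒪²}`), `endoGL_mem_unitaryGroupOfForm_formCongr_of_coe_eq_conj`
  (`Γ ∈ U(σ, formCongr σ P Φ₃)`), `finite_neighborSet_formCongr_of_finite_neighborSet`, `isSelfDualLattice_iff_not_of_adj_formCongr` (stars ∕ alternation in the model).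
* §2 **`finite_setOf_latticeGraphIso_antidiagonal_three_eq_of_coe_eq_conj_endoGL`** (`hΔ : det(γ₁ − u₀₀·1) ≠ 0` currency) and
  **`finite_setOf_latticeGraphIso_antidiagonal_three_eq_of_coe_eq_conj_endoGL_of_not_isRoot_charpoly`** (`hirr` currency).

HONEST LABEL: HC_CM is proved only modulo the 2 remaining named inputs (hLiu418 24832, h413 24833) until rung 0 closes; nothing printed is asserted here (elementary lattice
bookkeeping); «S3-ram» has no books consequence.

## References
* [BruhatTits1972] F. Bruhat, J. Tits, *Groupes réductifs sur un corps local I*, Publ. Math. IHÉS 41 (1972), §10 (lattice models; the building of an anisotropic group is a point).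
* [Kottwitz1986] R. E. Kottwitz, *Base change for unit elements of Hecke algebras*, Compositio Math. 60 (1986), §3 (finiteness of the fixed lattice set of an elliptic element).
* [Serre1980Trees] J.-P. Serre, *Trees* (1980), Ch. I §6.4, Ch. II §1.1, §1.3.
* [Rogawski1990] J. D. Rogawski, *Automorphic Representations of Unitary Groups in Three Variables*, Ann. of Math. Stud. 123 (1990), §4.8 Case (a) p. 53, §4.9 pp. 54–56.
-/

set_option autoImplicit false

noncomputable section

open scoped Valued WithZero Matrix MatrixGroups

namespace Literature.NumberTheory.Automorphic.UnitaryLatticeTree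

open Literature.NumberTheory.Automorphic Literature.NumberTheory.Automorphic.HermitianLattice Literature.NumberTheory.Rogawski1990

variable {K : Type*} [Field K] [Valued K ℤᵐ⁰]

/-! ## §1 The anisotropic `W`-side, unitarity of `Γ` in the model, and the graph hypotheses in the model -/

/-- **THE ANISOTROPIC `W`-SIDE IS FREE**: for a residually anisotropic unimodular plane `diag d`, `{B ∣ SD(diag d) B ∧ γ₁·B = B} ⊆ {𝒪²}` is finite (★ the only self-dual lattice is
the root). [cite: BruhatTits1972, §10] -/
theorem finite_setOf_selfDual_fixed_of_anisotropic {σ : K →+* K} (hvσ : ∀ a, Valued.v (σ a) = Valued.v a) {ϖ : K} (hϖ : Valued.v ϖ = WithZero.exp (-1 : ℤ))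
    {d : Fin 2 → K} (hd : ∀ i, Valued.v (d i) = 1)
    (hanis₀ : ∀ c : K, Valued.v c ≤ 1 → Valued.v (d 0 + d 1 * (σ c * c)) = 1)
    (hanis₁ : ∀ c : K, Valued.v c ≤ 1 → Valued.v (d 0 * (σ c * c) + d 1) = 1) (γ₁ : GL (Fin 2) K) :
    {B : Submodule 𝒪[K] (Fin 2 → K) | IsSelfDualLattice σ ϖ (Matrix.diagonal d) B ∧ mapGL γ₁ B = B}.Finite := by
  have hϖ0 : ϖ ≠ 0 := fun h0 => by rw [h0, map_zero] at hϖ; exact WithZero.coe_ne_zero hϖ.symm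
  have hϖ1 : Valued.v ϖ ≤ 1 := by rw [hϖ, ← WithZero.exp_zero]; exact WithZero.exp_le_exp.2 (by norm_num)
  refine (Set.finite_singleton (stdLattice K 2)).subset ?_
  rintro B ⟨hB, -⟩
  exact eq_stdLattice_of_isSelfDualLattice_of_anisotropic hvσ hd hanis₀ hanis₁ hϖ0 hϖ1 hB

omit [Valued K ℤᵐ⁰] in
/-- **`Γ ∈ U(σ, ᵗσ(P) H P)` when `γ ∈ U(σ, H)` and `↑γ = P·Γ·P⁻¹`** (`ᵗσ(Γ)·(ᵗσ(P)HP)·Γ = ᵗσ(PΓ) H (PΓ) = ᵗσ(γP) H (γP) = ᵗσ(P) H P`). [cite: Rogawski1990, §3.1 p. 19] -/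
theorem mem_unitaryGroupOfForm_formCongr_of_coe_eq_conj {N : ℕ} {σ : K →+* K} {H : Matrix (Fin N) (Fin N) K} (γ : unitaryGroupOfForm σ H) (P Γ : GL (Fin N) K)
    (hγ : ((γ : GL (Fin N) K)) = P * Γ * P⁻¹) : Γ ∈ unitaryGroupOfForm σ (formCongr σ P H) := by
  have hPΓ : P * Γ = (γ : GL (Fin N) K) * P := by rw [hγ, inv_mul_cancel_right]
  show formCongr σ Γ (formCongr σ P H) = formCongr σ P H
  rw [← formCongr_mul σ H P Γ, hPΓ, formCongr_mul_of_mem σ H γ.2 P]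

/-- **FINITE STARS MOVE TO THE MODEL** along the graph isomorphism `M ↦ P·M` (★ `exists_iso_latticeGraph_formCongr`). [cite: BruhatTits1972, §10] [cite: Serre1980Trees, II.1.1] -/
theorem finite_neighborSet_formCongr_of_finite_neighborSet {N : ℕ} (σ : K →+* K) (ϖ : K) (H : Matrix (Fin N) (Fin N) K) (P : GL (Fin N) K)
    (hloc : ∀ v, ((latticeGraph σ ϖ H).neighborSet v).Finite) (v : {M : Submodule 𝒪[K] (Fin N → K) // IsVertex σ ϖ (formCongr σ P H) M}) :
    ((latticeGraph σ ϖ (formCongr σ P H)).neighborSet v).Finite := by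
  obtain ⟨φ, -⟩ := exists_iso_latticeGraph_formCongr σ ϖ H P
  haveI := (hloc (φ v)).to_subtype
  exact Set.finite_coe_iff.1 (Finite.of_equiv _ (φ.mapNeighborSet v).symm)

/-- **ALTERNATION MOVES TO THE MODEL**: if vertex types alternate along the edges of the lattice graph of `H`, they do so in the model `ᵗσ(P) H P` (self-duality corresponds under
`M ↦ P·M`, ★ `isSelfDualLattice_formCongr_iff`; edges correspond, ★ `exists_iso_latticeGraph_formCongr`). [cite: BruhatTits1972, §10] [cite: Serre1980Trees, II.1.1] -/
theorem isSelfDualLattice_iff_not_of_adj_formCongr {N : ℕ} (σ : K →+* K) (ϖ : K) (H : Matrix (Fin N) (Fin N) K) (P : GL (Fin N) K)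
    (halt : ∀ v w, (latticeGraph σ ϖ H).Adj v w → (IsSelfDualLattice σ ϖ H v.1 ↔ ¬ IsSelfDualLattice σ ϖ H w.1))
    (v w : {M : Submodule 𝒪[K] (Fin N → K) // IsVertex σ ϖ (formCongr σ P H) M}) (h : (latticeGraph σ ϖ (formCongr σ P H)).Adj v w) :
    IsSelfDualLattice σ ϖ (formCongr σ P H) v.1 ↔ ¬ IsSelfDualLattice σ ϖ (formCongr σ P H) w.1 := by
  obtain ⟨φ, hφ⟩ := exists_iso_latticeGraph_formCongr σ ϖ H P
  rw [isSelfDualLattice_formCongr_iff, isSelfDualLattice_formCongr_iff, ← hφ v, ← hφ w]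
  exact halt _ _ (φ.map_adj_iff.2 h)

/-! ## §2 The `Φ₃`-dress of the opposite literal -/

set_option maxHeartbeats 800000 in
-- budget only: statement-heavy lattice tokens.
/-- **THE J₀ DRESS OF (z6) AT THE OPPOSITE LITERAL — the `hFfin` binder of `strataCount_J₀_block` for `γ` with `↑γ = P·ι(γ₁, u)·P⁻¹`.**  Under the tame-ramified hypotheses
`(hσ hvσ hσϖ hϖ hres h2 hnorm)`, with the block frame `formCongr σ P Φ₃ = ι-shape(diag d, η)` of ★ `exists_vDeep_oppositeLiteral_frame_ram` (`|d i| = 1`, `σ d i = d i`, `diag d`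
residually anisotropic, `σ η = η`, `|η| = 1`), `|tr(γ₁ − u₀₀·1)| ≤ 1` and `det(γ₁ − u₀₀·1) ≠ 0`: the fixed vertex set `{v ∣ γ·v = v}` of the lattice graph of `Φ₃` is FINITE — no
`W`-side input (the anisotropic plane has one self-dual lattice). [cite: Kottwitz1986, §3] [cite: BruhatTits1972, §10] [cite: Rogawski1990, §4.9 pp. 54–56] -/
theorem finite_setOf_latticeGraphIso_antidiagonal_three_eq_of_coe_eq_conj_endoGL [ValuativeRel K] [(Valued.v : Valuation K ℤᵐ⁰).Compatible]
    [IsPrincipalIdealRing 𝒪[K]] [Finite 𝓀[K]] {σ : K →+* K} {ϖ : K}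
    (hσ : ∀ x, σ (σ x) = x) (hvσ : ∀ a, Valued.v (σ a) = Valued.v a) (hσϖ : σ ϖ = -ϖ)
    (hϖ : Valued.v ϖ = WithZero.exp (-1 : ℤ)) (hres : ∀ x : K, Valued.v x ≤ 1 → Valued.v (σ x - x) < 1) (h2 : Valued.v (2 : K) = 1)
    (hnorm : ∀ u : K, σ u = u → Valued.v (u - 1) < 1 → ∃ z : K, z * σ z = u ∧ Valued.v (z - 1) ≤ Valued.v (u - 1))
    {d : Fin 2 → K} {η : K} (P : GL (Fin 3) K)
    (hP : formCongr σ P ((StdForm.antidiagonal 3).over K) =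
      !![(Matrix.diagonal d) 0 0, 0, (Matrix.diagonal d) 0 1; 0, η, 0; (Matrix.diagonal d) 1 0, 0, (Matrix.diagonal d) 1 1])
    (hd : ∀ i, Valued.v (d i) = 1) (hdσ : ∀ i, σ (d i) = d i)
    (hanis₀ : ∀ c : K, Valued.v c ≤ 1 → Valued.v (d 0 + d 1 * (σ c * c)) = 1)
    (hanis₁ : ∀ c : K, Valued.v c ≤ 1 → Valued.v (d 0 * (σ c * c) + d 1) = 1)
    (hησ : σ η = η) (hη : Valued.v η = 1)
    (γ : unitaryGroupOfForm σ ((StdForm.antidiagonal 3).over K)) (γ₁ : GL (Fin 2) K) (u : GL (Fin 1) K)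
    (hγ : (γ : GL (Fin 3) K) = P * endoGL (γ₁, u) * P⁻¹)
    (htr : Valued.v ((γ₁ : Matrix (Fin 2) (Fin 2) K) - (u : Matrix (Fin 1) (Fin 1) K) 0 0 • (1 : Matrix (Fin 2) (Fin 2) K)).trace ≤ 1)
    (hΔ : ((γ₁ : Matrix (Fin 2) (Fin 2) K) - (u : Matrix (Fin 1) (Fin 1) K) 0 0 • (1 : Matrix (Fin 2) (Fin 2) K)).det ≠ 0) :
    {v : {M : Submodule 𝒪[K] (Fin 3 → K) // IsVertex σ ϖ ((StdForm.antidiagonal 3).over K) M} |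
      latticeGraphIso σ ϖ ((StdForm.antidiagonal 3).over K) γ v = v}.Finite := by
  -- the block `diag d`
  have hd0 : ∀ i, d i ≠ 0 := fun i h0 => by have h := hd i; rw [h0, map_zero] at h; exact zero_ne_one h
  have hH₂ : IsUnit (Matrix.diagonal d).det := by
    rw [Matrix.det_diagonal]
    exact isUnit_iff_ne_zero.2 (Finset.prod_ne_zero_iff.2 fun i _ => hd0 i)
  have hH₂σ : ((Matrix.diagonal d).map σ)ᵀ = Matrix.diagonal d := by
    rw [Matrix.diagonal_map (map_zero σ), Matrix.diagonal_transpose]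
    exact congrArg Matrix.diagonal (funext hdσ)
  -- the model and the element `Γ = ι(γ₁, u)` in it
  let γ' : unitaryGroupOfForm σ (formCongr σ P ((StdForm.antidiagonal 3).over K)) :=
    ⟨endoGL (γ₁, u), mem_unitaryGroupOfForm_formCongr_of_coe_eq_conj γ P _ hγ⟩
  have hγ' : ((γ' : GL (Fin 3) K)) = endoGL (γ₁, u) := rfl
  have hfin' := finite_setOf_latticeGraphIso_endoGL_eq_of_det_ne_zero σ hσ hvσ hϖ hH₂ hH₂σ hη hησ hP
    ((isTree_latticeGraph_formCongr_iff σ ϖ _ P).2 (isTree_latticeGraph_three_of_neg hσ hvσ hϖ hσϖ hres h2 hnorm))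
    (isSelfDualLattice_iff_not_of_adj_formCongr σ ϖ _ P fun _ _ hadj => isSelfDualLattice_iff_not_isSelfDualLattice_of_adj_of_v hvσ hϖ hadj)
    (finite_neighborSet_formCongr_of_finite_neighborSet σ ϖ _ P (finite_neighborSet_of_ramified hσ hvσ hσϖ hϖ hres h2 hnorm))
    γ' γ₁ u hγ' htr hΔ (finite_setOf_selfDual_fixed_of_anisotropic hvσ hϖ hd hanis₀ hanis₁ γ₁)
  exact finite_setOf_latticeGraphIso_eq_of_model σ ϖ (c := 1) (by rw [map_one]) ((StdForm.antidiagonal 3).over K) P (by rw [one_smul]) γ γ' hγ hfin'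

set_option maxHeartbeats 800000 in
-- budget only: statement-heavy lattice tokens.
/-- **THE J₀ DRESS OF (z6) AT THE OPPOSITE LITERAL, `hirr` CURRENCY**: as `finite_setOf_latticeGraphIso_antidiagonal_three_eq_of_coe_eq_conj_endoGL` with `det(γ₁ − u₀₀·1) ≠ 0`
replaced by «`u₀₀` is not a root of `χ_{γ₁}`» (`χ_{γ₁} = χ_{γ₂}` has no root in `K`). [cite: Kottwitz1986, §3] [cite: Rogawski1990, §4.9 pp. 54–56] -/
theorem finite_setOf_latticeGraphIso_antidiagonal_three_eq_of_coe_eq_conj_endoGL_of_not_isRoot_charpoly [ValuativeRel K] [(Valued.v : Valuation K ℤᵐ⁰).Compatible]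
    [IsPrincipalIdealRing 𝒪[K]] [Finite 𝓀[K]] {σ : K →+* K} {ϖ : K}
    (hσ : ∀ x, σ (σ x) = x) (hvσ : ∀ a, Valued.v (σ a) = Valued.v a) (hσϖ : σ ϖ = -ϖ)
    (hϖ : Valued.v ϖ = WithZero.exp (-1 : ℤ)) (hres : ∀ x : K, Valued.v x ≤ 1 → Valued.v (σ x - x) < 1) (h2 : Valued.v (2 : K) = 1)
    (hnorm : ∀ u : K, σ u = u → Valued.v (u - 1) < 1 → ∃ z : K, z * σ z = u ∧ Valued.v (z - 1) ≤ Valued.v (u - 1))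
    {d : Fin 2 → K} {η : K} (P : GL (Fin 3) K)
    (hP : formCongr σ P ((StdForm.antidiagonal 3).over K) =
      !![(Matrix.diagonal d) 0 0, 0, (Matrix.diagonal d) 0 1; 0, η, 0; (Matrix.diagonal d) 1 0, 0, (Matrix.diagonal d) 1 1])
    (hd : ∀ i, Valued.v (d i) = 1) (hdσ : ∀ i, σ (d i) = d i)
    (hanis₀ : ∀ c : K, Valued.v c ≤ 1 → Valued.v (d 0 + d 1 * (σ c * c)) = 1)
    (hanis₁ : ∀ c : K, Valued.v c ≤ 1 → Valued.v (d 0 * (σ c * c) + d 1) = 1)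
    (hησ : σ η = η) (hη : Valued.v η = 1)
    (γ : unitaryGroupOfForm σ ((StdForm.antidiagonal 3).over K)) (γ₁ : GL (Fin 2) K) (u : GL (Fin 1) K)
    (hγ : (γ : GL (Fin 3) K) = P * endoGL (γ₁, u) * P⁻¹)
    (htr : Valued.v ((γ₁ : Matrix (Fin 2) (Fin 2) K) - (u : Matrix (Fin 1) (Fin 1) K) 0 0 • (1 : Matrix (Fin 2) (Fin 2) K)).trace ≤ 1)
    (hirr : ¬ (γ₁ : Matrix (Fin 2) (Fin 2) K).charpoly.IsRoot ((u : Matrix (Fin 1) (Fin 1) K) 0 0)) :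
    {v : {M : Submodule 𝒪[K] (Fin 3 → K) // IsVertex σ ϖ ((StdForm.antidiagonal 3).over K) M} |
      latticeGraphIso σ ϖ ((StdForm.antidiagonal 3).over K) γ v = v}.Finite := by
  refine finite_setOf_latticeGraphIso_antidiagonal_three_eq_of_coe_eq_conj_endoGL hσ hvσ hσϖ hϖ hres h2 hnorm P hP hd hdσ hanis₀ hanis₁ hησ hη γ γ₁ u hγ htr ?_
  rw [← eval_charpoly_fin_two_eq_det_sub_smul_one]
  exact hirr

end Literature.NumberTheory.Automorphic.UnitaryLatticeTree

end
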